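import Summits.NavierStokesRegularity.NavierStokesRegularity.Theorems.StrainDoorsDirectionDoorK5Closed
import Summits.NavierStokesRegularity.NavierStokesRegularity.Theorems.StrainDoorsNearRecordGradientDeficit
import HarnessLib

/-!
# StrainDoorsPeakHeightFloor — PART K consequences of the small-vorticity-number Liouville theorem (P1)

LEAD plate of the S-door lane (ns-s30-p1 g6; helper lane of `stmt-NavierStokesRegularity-0056`, rung N0;
`--supports stmt-NavierStokesRegularity-0056 --as helper`).  No new definitions; no sorry.  Compositions of landed
theorems: ROUND 65's typed input (P1) `SmallVorticityNumberLiouville` is a theorem (`smallVorticityNumberLiouville_holds`,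
R66 text N4; also `eq_zero_of_typeIAncientMild_of_small_vorticityNumber`, LEAD plate `StrainDoorsTypeIAncientCompactness`),
so its PART K consequences become unconditional:

* ★★ `peak_height_floor` — PEAK HEIGHT FLOOR on the Type-I tangent peak class: `∃ η(C₀) > 0`, every peak `(v, z̄)` has
  `η < |ω_v(−1, z̄)|` (R65 N2's `peak_height_floor_of_smallVorticityNumberLiouville` discharged) — the FLOOR companion
  of PART K's ceiling `peak_height_le_of_twistFloor` (`ρ̄ ≤ K₃(C₀)/κ` under a twist floor `κ`);
* ★★ `peakClassEmpty_of_large_twistFloor` — consequently DOOR K-β WITH A LARGE CONSTANT CLOSES BY ITSELF: there is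
  `κ₀(C₀) ≥ 0` with `PeakTwistFloor C₀ κ → PeakClassEmpty C₀` for every `κ > κ₀` (ceiling `K₃/κ < η` contradicts the
  floor; no stretching cap K-γ needed in this regime — the small-`κ` door stays `peakClassEmpty_of_twistFloor_of_cap`);
  `eq_zero_of_typeI_of_large_twistFloor` — the u-side Type-I Liouville theorem through PART K's consumer;
* ★★ `typeI_vorticityNumber_gap`, `typeI_vorticityNumber_floor` — (P1) on classical Type-I solutions (R65 N1's bridge
  `isTypeIAncientMild_of_typeI`): `(0 − s)|ω(s,y)| ≤ η(C₀)` everywhere ⇒ `u ≡ 0`; every global bound `W` of the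
  vorticity number of a solution with `ω ≢ 0` has `η ≤ W`;
* ★★ `typeI_nearRecord_gradient_rate_univ`, `typeI_nearRecord_gradient_pinch_univ` — ROUND 63 §M7's first-order
  near-record law `(0 − t)^{3/2}‖∇|ω|(t,x)‖ ≤ A√δ` and its pinch with the threshold hypothesis `w₀ ≤ W` REMOVED: one
  `A(C₀)`, one `δ₀(C₀) > 0` for EVERY classical Type-I solution under GLOBAL domination (trivial solutions have left side
  `0`; non-trivial ones have `W ≥ η(C₀)`).

WHAT THIS IS NOT: door compositions and necessary conditions for a HYPOTHETICAL Type-I blow-up profile; `η(C₀)`,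
`κ₀(C₀)` are ineffective (compactness); nothing here excludes a blow-up; `0056` / `10661` / NS regularity are NOT proved;
doors K-α…K-δ of PART K stay OPEN for `κ ≤ κ₀`.
[cite: KochNadirashviliSereginSverak2009, §4, Lemma 6.1 (arXiv:0709.3599); GigaMiura2011, §2]
-/

noncomputable section

open MeasureTheory Set Function Filter Metric Real InnerProductSpace
open _root_.Topology
open scoped ENNReal NNReal RealInnerProductSpace ContDiff
open Literature.Analysis Literature.Analysis.FluidPDE
open Literature.Analysis.FluidPDE.VorticityDirectionDynamics

set_option linter.dupNamespace false

namespace Summit.NavierStokesRegularity.NavierStokesRegularity.Theorems.StrainDoors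

open Summit.NavierStokesRegularity.NavierStokesRegularity.Theorems.ArgmaxDoors

/-! ## §1 The peak height floor and the large-twist door -/

/-- ★★ **PEAK HEIGHT FLOOR (unconditional).**  For every `C₀` there is `η = η(C₀) > 0` such that every Type-I tangent
peak `(v, z̄)` with constant `C₀` has `η < |ω_v(−1, z̄)|` — R65's `peak_height_floor_of_smallVorticityNumberLiouville` with
its hypothesis (P1) discharged by R66's `smallVorticityNumberLiouville_holds`. [tree composition] -/
theorem peak_height_floor (C₀ : ℝ) :
    ∃ η : ℝ, 0 < η ∧ ∀ (v : ℝ → EuclideanSpace ℝ (Fin 3) → EuclideanSpace ℝ (Fin 3)) (zbar : EuclideanSpace ℝ (Fin 3)),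
      IsTypeITangentPeak C₀ v zbar → η < ‖curl (v (-1)) zbar‖ :=
  peak_height_floor_of_smallVorticityNumberLiouville smallVorticityNumberLiouville_holds C₀

/-- ★★ **DOOR K-β WITH A LARGE CONSTANT CLOSES BY ITSELF.**  For every `C₀` there is `κ₀ = κ₀(C₀) ≥ 0` (namely
`K₃(C₀)/η(C₀)`: PART J's Laplacian bound over the floor) such that `PeakTwistFloor C₀ κ` with `κ₀ < κ` implies
`PeakClassEmpty C₀`: the ceiling `ρ̄ ≤ K₃/κ < η` of `peak_height_le_of_twistFloor` contradicts the floor `η < ρ̄`.  No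
stretching cap is needed in this regime. [tree composition] -/
theorem peakClassEmpty_of_large_twistFloor (C₀ : ℝ) :
    ∃ κ₀ : ℝ, 0 ≤ κ₀ ∧ ∀ (κ : ℝ), κ₀ < κ → PeakTwistFloor C₀ κ → PeakClassEmpty C₀ := by
  obtain ⟨K₃, hK₃, hceil⟩ := peak_height_le_of_twistFloor C₀
  obtain ⟨η, hη, hfloor⟩ := peak_height_floor C₀
  refine ⟨K₃ / η, by positivity, fun κ hκ hfl v zbar hP => ?_⟩
  have hκpos : 0 < κ := lt_of_le_of_lt (by positivity) hκ
  have h1 : η < ‖curl (v (-1)) zbar‖ := hfloor v zbar hP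
  have h2 : ‖curl (v (-1)) zbar‖ ≤ K₃ / κ := hceil hκpos hfl v zbar hP
  have h3 : K₃ < κ * η := (div_lt_iff₀ hη).mp hκ
  have h4 : K₃ / κ < η := by rw [div_lt_iff₀ hκpos]; linarith [mul_comm κ η]
  linarith

/-- ★★ **LARGE TWIST FLOOR ⇒ TYPE-I LIOUVILLE** (PART K's consumer `eq_zero_of_typeI_of_peakClassEmpty`): with `κ₀(C₀)` of
`peakClassEmpty_of_large_twistFloor`, door K-β with any `κ > κ₀` forces every classical Type-I solution with constant `C₀`
on `(−∞,0)` to vanish identically. [tree composition] -/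
theorem eq_zero_of_typeI_of_large_twistFloor (C₀ : ℝ) :
    ∃ κ₀ : ℝ, 0 ≤ κ₀ ∧ ∀ (κ : ℝ), κ₀ < κ → PeakTwistFloor C₀ κ →
      ∀ (u : ℝ → EuclideanSpace ℝ (Fin 3) → EuclideanSpace ℝ (Fin 3)) (p : ℝ → EuclideanSpace ℝ (Fin 3) → ℝ),
        IsClassicalNSSolutionOn (Iio 0) 1 0 u p → HasTypeIDecay C₀ u →
        ∀ t : ℝ, t < 0 → ∀ x : EuclideanSpace ℝ (Fin 3), u t x = 0 := by
  obtain ⟨κ₀, hκ₀, hE⟩ := peakClassEmpty_of_large_twistFloor C₀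
  exact ⟨κ₀, hκ₀, fun κ hκ hfl u p hsol hI => eq_zero_of_typeI_of_peakClassEmpty (hE κ hκ hfl) hsol hI⟩

/-! ## §2 The vorticity-number gap of the classical Type-I class -/

/-- ★★ **VORTICITY-NUMBER GAP (classical frame).**  For every `C₀` there is `η = η(C₀) > 0` such that every classical
solution of Navier–Stokes on `(−∞,0) × ℝ³` (`ν = 1`, `f = 0`) with Type-I decay `|u(t,x)| ≤ C₀/(|x| + √(−t))` and
`(0 − s)|ω(s,y)| ≤ η` for all `s < 0`, `y` vanishes identically ((P1) through R65's bridge `isTypeIAncientMild_of_typeI`).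
[tree composition] -/
theorem typeI_vorticityNumber_gap (C₀ : ℝ) :
    ∃ η : ℝ, 0 < η ∧
      ∀ (u : ℝ → EuclideanSpace ℝ (Fin 3) → EuclideanSpace ℝ (Fin 3)) (p : ℝ → EuclideanSpace ℝ (Fin 3) → ℝ),
        IsClassicalNSSolutionOn (Iio 0) 1 0 u p → HasTypeIDecay C₀ u →
        (∀ s : ℝ, s < 0 → ∀ y : EuclideanSpace ℝ (Fin 3), (0 - s) * ‖curl (u s) y‖ ≤ η) →
        ∀ t : ℝ, t < 0 → ∀ x : EuclideanSpace ℝ (Fin 3), u t x = 0 := by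
  obtain ⟨η, hη, hP1⟩ := smallVorticityNumberLiouville_holds C₀
  exact ⟨η, hη, fun u p hsol hI hsmall => hP1 u (isTypeIAncientMild_of_typeI hsol hI) hsmall⟩

/-- ★★ **VORTICITY-NUMBER FLOOR.**  With `η(C₀)` of the gap: for a classical Type-I solution with `ω ≢ 0`, every global
upper bound `W` of the vorticity number satisfies `η ≤ W`. [tree composition] -/
theorem typeI_vorticityNumber_floor (C₀ : ℝ) :
    ∃ η : ℝ, 0 < η ∧
      ∀ (u : ℝ → EuclideanSpace ℝ (Fin 3) → EuclideanSpace ℝ (Fin 3)) (p : ℝ → EuclideanSpace ℝ (Fin 3) → ℝ) (W : ℝ),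
        IsClassicalNSSolutionOn (Iio 0) 1 0 u p → HasTypeIDecay C₀ u →
        (∃ t₀ : ℝ, t₀ < 0 ∧ ∃ x₀ : EuclideanSpace ℝ (Fin 3), curl (u t₀) x₀ ≠ 0) →
        (∀ s : ℝ, s < 0 → ∀ y : EuclideanSpace ℝ (Fin 3), (0 - s) * ‖curl (u s) y‖ ≤ W) → η ≤ W := by
  obtain ⟨η, hη, hgap⟩ := typeI_vorticityNumber_gap C₀
  refine ⟨η, hη, fun u p W hsol hI hne hdom => ?_⟩
  by_contra hW
  push Not at hW
  obtain ⟨t₀, ht₀, x₀, hx₀⟩ := hne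
  have hzero := hgap u p hsol hI (fun s hs y => (hdom s hs y).trans hW.le)
  have hslice : u t₀ = 0 := funext fun y => hzero t₀ ht₀ y
  exact hx₀ (by rw [hslice]; exact curl_zero x₀)

/-! ## §3 ROUND 63's first-order near-record law, threshold-free -/

/-- ★★ **THE NEAR-RECORD GRADIENT LAW WITH A RATE, THRESHOLD-FREE.**  For every `C₀ ≥ 0` there are `A = A(C₀) ≥ 0` and
`δ₀ = δ₀(C₀) > 0` such that at every point of every classical Type-I solution where the scale-invariant vorticity is
within `δ ≤ δ₀` of a GLOBAL upper bound `W` of the vorticity number: `(0 − t)^{3/2}‖∇|ω|(t,x)‖ ≤ A√δ` — ROUND 63's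
`typeI_nearRecord_gradient_rate` with `w₀ ≤ W` discharged by the floor (`ω ≢ 0 ⇒ η ≤ W`; `ω ≡ 0 ⇒` the left side is `0`).
[tree composition] -/
theorem typeI_nearRecord_gradient_rate_univ {C₀ : ℝ} (hC₀ : 0 ≤ C₀) :
    ∃ A δ₀ : ℝ, 0 ≤ A ∧ 0 < δ₀ ∧
      ∀ (u : ℝ → EuclideanSpace ℝ (Fin 3) → EuclideanSpace ℝ (Fin 3)) (p : ℝ → EuclideanSpace ℝ (Fin 3) → ℝ)
        (W t δ : ℝ) (x : EuclideanSpace ℝ (Fin 3)),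
        IsClassicalNSSolutionOn (Iio 0) 1 0 u p → HasTypeIDecay C₀ u → t < 0 →
        (∀ s : ℝ, s < 0 → ∀ y : EuclideanSpace ℝ (Fin 3), (0 - s) * ‖curl (u s) y‖ ≤ W) → 0 ≤ δ → δ ≤ δ₀ →
        W - δ ≤ (0 - t) * ‖curl (u t) x‖ →
        (0 - t) * √(0 - t) * ‖fderiv ℝ (fun y => ‖curl (u t) y‖) x‖ ≤ A * √δ := by
  obtain ⟨η, hη, hfloor⟩ := typeI_vorticityNumber_floor C₀
  obtain ⟨A, hA, hrate⟩ := typeI_nearRecord_gradient_rate hC₀ hη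
  refine ⟨A, η / 2, hA, half_pos hη, fun u p W t δ x hsol hI ht hdom hδ hδ1 hnear => ?_⟩
  by_cases hne : ∃ t₀ : ℝ, t₀ < 0 ∧ ∃ x₀ : EuclideanSpace ℝ (Fin 3), curl (u t₀) x₀ ≠ 0
  · exact hrate u p W t δ x hsol hI ht (hdom t ht) (hfloor u p W hsol hI hne hdom) hδ hδ1 hnear
  · push Not at hne
    have hz : (fun y => ‖curl (u t) y‖) = fun _ => (0 : ℝ) :=
      funext fun y => by rw [hne t ht y, norm_zero]
    have hfz : fderiv ℝ (fun _ : EuclideanSpace ℝ (Fin 3) => (0 : ℝ)) x = 0 := by simp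
    rw [hz, hfz, norm_zero, mul_zero]
    positivity

/-- ★★ **NEAR-RECORD ε-CRITICALITY OF THE VORTICITY MODULUS, THRESHOLD-FREE**: for all `C₀`, `ε > 0` there is
`δ = δ(C₀, ε) > 0` such that at every point of every classical Type-I solution (constant `C₀`) where the scale-invariant
vorticity comes within `δ` of a global upper bound `W` of its vorticity number, `(0 − t)^{3/2}‖∇|ω|(t,x)‖ ≤ ε` — ROUND 63's
`typeI_nearRecord_gradient_pinch` with `w₀ ≤ W` removed. [tree composition] -/
theorem typeI_nearRecord_gradient_pinch_univ (C₀ ε : ℝ) (hε : 0 < ε) :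
    ∃ δ : ℝ, 0 < δ ∧
      ∀ (u : ℝ → EuclideanSpace ℝ (Fin 3) → EuclideanSpace ℝ (Fin 3)) (p : ℝ → EuclideanSpace ℝ (Fin 3) → ℝ)
        (W t : ℝ) (x : EuclideanSpace ℝ (Fin 3)),
        IsClassicalNSSolutionOn (Iio 0) 1 0 u p → HasTypeIDecay C₀ u →
        (∀ s : ℝ, s < 0 → ∀ y : EuclideanSpace ℝ (Fin 3), (0 - s) * ‖curl (u s) y‖ ≤ W) → t < 0 →
        W - δ ≤ (0 - t) * ‖curl (u t) x‖ →
        (0 - t) * √(0 - t) * ‖fderiv ℝ (fun y => ‖curl (u t) y‖) x‖ ≤ ε := by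
  by_cases hC₀ : 0 ≤ C₀
  · obtain ⟨A, δ₀, hA, hδ₀, hrate⟩ := typeI_nearRecord_gradient_rate_univ hC₀
    refine ⟨min δ₀ ((ε / (A + 1)) ^ 2), lt_min hδ₀ (by positivity),
      fun u p W t x hsol hI hdom ht hnear => ?_⟩
    have h := hrate u p W t (min δ₀ ((ε / (A + 1)) ^ 2)) x hsol hI ht hdom
      (le_min hδ₀.le (by positivity)) (min_le_left _ _) hnear
    have hs : √(min δ₀ ((ε / (A + 1)) ^ 2)) ≤ ε / (A + 1) := by
      rw [← Real.sqrt_sq (by positivity : (0:ℝ) ≤ ε / (A + 1))]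
      exact Real.sqrt_le_sqrt (by rw [Real.sqrt_sq (by positivity)]; exact min_le_right _ _)
    have h2 : A * (ε / (A + 1)) ≤ ε := by
      rw [mul_div_assoc', div_le_iff₀ (by positivity)]
      nlinarith
    nlinarith [mul_le_mul_of_nonneg_left hs hA]
  · refine ⟨1, one_pos, fun u p W t x hsol hI hdom ht hnear => ?_⟩
    exact absurd (HasTypeIDecay.nonneg' hI) hC₀

end Summit.NavierStokesRegularity.NavierStokesRegularity.Theorems.StrainDoors

end
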